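import Literature.MathematicalPhysics.QuantumFieldTheory.BalabanImbrieJaffe1984to88.BIJ88Eq5514Torus
import Literature.MathematicalPhysics.QuantumFieldTheory.BalabanImbrieJaffe1984to88.BIJ88Smooth43Phase

/-!
# `BalabanImbrieJaffe1984to88.BIJ88Regularity561` — T. Bałaban, J. Imbrie, A. Jaffe, *Effective action and cluster properties of the abelian
Higgs model*, Commun. Math. Phys. **114** (1988) 257–315 [BalabanImbrieJaffe1988], p. 286 [PDF 30], the end of the verification of the
regularity condition for the new background field `ũ_{k+1}` of (5.6.1): *"We then made a gauge transformation and removed the small kernel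
w₁. The gauge transformation does not change the regularity, and ∂w₁, ∂*w₁ are small, so the bounds remain valid. After another translation
we removed the field θ_kH_{k,loc}A^{(k)}. This field satisfies ∂(θ_kH_{k,loc}A^{(k)}) ≦ cp(e_k) because A^{(k)} ≦ cp(e_k) and because
∂H_{k,loc}, H_{k,loc}, and derivatives of θ_k are bounded. Similarly ∂*(θ_kH_{k,loc}A^{(k)}), θ_kH_{k,loc}A^{(k)} are bounded by cp(e_k). Thus
removing θ_kH_{k,loc}A^{(k)} does not spoil the regularity, and ũ_{k+1} satisfies the regularity condition."* — AS A THEOREM ABOUT THE FIELD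
(5.6.1) (r16's `uTilde561`) and r16's typed regularity condition `Regular286` (row `C2.Claim@286`): `ũ_{k+1} = u′_k · exp(−ie_kη[θ_kH_{k,loc}
A^{(k)} + w₁A′])` ((5.6.6) inverted), so the regularity of `u′_k` ((5.5.14)) on a family of `r(e_k)`-cubes and the three printed bounds on the
removed field give the regularity of `ũ_{k+1}` with the constant enlarged by the bound (p36's *"does not spoil the regularity"* algebra
`BIJ88Smooth43Phase.regular286_of_bgExp`).

statement-level skeleton of published theorems with citation tags; proofs where landed; nothing here is a claim about the Yang–Mills mass gap

PDF held: `paper:balaban1988-cmp114-bij-abelian-higgs-effective-action` (journal page = PDF page + 256); p. 286 [PDF 30] rendered and read as an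
image this session (seat folder `renders/original-p030-x2.png`).

CITATION HEADER (lean-in-tree rule).  Part of the lit-balaban TYPED SKELETON (HOME `run/shared/lean/pub/lit-balaban/`), PHASE-2 proof
seat p31 gen 8 (unit `lit-balaban-p31-g8`; fifth file of the gen; TAKING line HOME/STATUS.md 2026-08-21T19:18:06Z).  WHAT IS REPRODUCED: row
`C2.Claim@286` of `HOME/lit-balaban-r16/ROWS-C2-part2.md` (owner r16; typed `BIJ88Regularity286.Regular286` p247117; verification chain
assembled on the torus by p36 gen 6 (`BIJ88Smooth43Axial`, `BIJ88Smooth43Phase`) and this seat's gen 6 (`BIJ88Eq564Torus`)), the LAST two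
sentences of the chain, for the field (5.6.1) of row `C2.Eq5.6.1-5.6.2` (this gen's `BIJ88Eq5514Torus.eq566_torus` gives (5.6.6) on the torus).

WHAT IS PROVED, and what is data.  ABSTRACT over the prefactor `Q = Q^{s*}_{k+1}v` and the real η-bond functions `HA = H_{k,loc}A^{(k)}`,
`DXf = 𝒟^η_{k+1,loc}∂*Q^{e*}_{k+1}f`, `wA = w₁A′`, `θ = θ_k` (exactly r16's data of `uTilde561`/`uSmall566`): the (5.5.14) field is `bgExp e_k η
Q (HA − L^{−2}DXf + wA)`, the (5.6.1) field is `uTilde561 e_k η L Q θ HA DXf`, and (5.6.6) (r16's `eq566`) says the former is the latter times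
`exp ie_kη[θ·HA + wA]` — `bgExp_bracket5514` below, as an identity of fields.  HYPOTHESES: the regularity of the (5.5.14) field `u′_k` on a
family `G` of cubes (r16's `Regular286 cube G e_k η c p(e_k) r(e_k)`), and the three printed bounds on the removed field `g = θ_kH_{k,loc}A^{(k)}
+ w₁A′` on those cubes: `|g| ≦ c′pr`, `|∂^ηg| ≦ c′pr`, `|∂^{η*}g| ≦ c′pr` (`∂^η = curl η⁻¹`, `∂^{η*} = diverg η⁻¹` as in `Smooth43`; p. 286
derives them from `A^{(k)} ≦ cp(e_k)` and kernel bounds — analytic inputs, not here).  CONCLUSION: `Regular286 cube G e_k η (c + c′) p(e_k)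
r(e_k) (uTilde561 …)`.  THE TORUS INSTANCE `regular286_uTilde561_torus`: `Q = qsstarGIter (k+1) v` read in `ℂ`, `HA = H_{k,loc}A`, `DXf =
𝒟^η_{k+1,loc}X_f`, and the (5.5.14) field given as ANY function `U′` agreeing with the (5.5.14) form on the bonds of the cubes (which is what
`BIJ88Eq5514Torus.eq5514_torus` provides bond by bond for the transformed translated background field) — r16's `regular286_of_eqOn`.
* `bgExp_bracket5514` ((5.6.6) as an identity of fields: `u′_k = bgExp (ũ_{k+1}) (θ·HA + wA)`), `uTilde561_eq_mul_exp_neg` (`ũ_{k+1} = u′_k ·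
  e^{−ie_kη g}` pointwise), **`regular286_uTilde561`**, **`regular286_uTilde561_torus`**.
HONEST SCOPE.  Not here: the three bounds themselves (kernel bounds on `H_{k,loc}`, `∂H_{k,loc}`, `w₁`, `∂w₁`, `∂*w₁`, derivatives of `θ_k`;
`A^{(k)} ≦ cp(e_k)` is (5.9.4)), the *"j-th regularity condition for r(e_k)-cubes"* (last sentence of p. 286), the first links of the chain
((5.6.3)–(5.6.5): gen 6 + p36 gen 6).  Imports: this seat's `BIJ88Eq5514Torus` (p299521) and p36 gen 6's `BIJ88Smooth43Phase` (p260437/p260588).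
Unit `lit-balaban-p31` (literature-prover-lit-balaban-p31-g8-0), 2026-08-21.
-/

namespace Literature.MathematicalPhysics.QuantumFieldTheory.BalabanImbrieJaffe1984to88.BIJ88Regularity561

open Literature.MathematicalPhysics.QuantumFieldTheory.Balaban1983to89
open BIJ88Sect3Statements (U1 toC starB starP)
open BIJ88Regularity286 (Regular286 cubeSites regular286_of_eqOn)
open BIJ88Sect5StatementsPart3 (bgExp uTilde561 uSmall566 bracket561 eq566)
open BIJ88Smooth43Phase (regular286_of_bgExp)
open BIJ85Eq453GaugeField (qsstarGIter)
open LatticeFieldCalculus (curl diverg)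
open scoped BigOperators Real
open Complex Finset

noncomputable section

variable {P : Params} {j : ℕ}

/-- kernel: **(5.6.6) as an identity of fields** — the (5.5.14) field `(Q^{s*}_{k+1}v) exp ie_kη[H_{k,loc}A^{(k)} − L^{−2}DXf + w₁A′]` IS r16's
`bgExp` of the (5.6.1) field `ũ_{k+1}` by the removed field `θ_kH_{k,loc}A^{(k)} + w₁A′` (r16's pointwise `eq566`, `uSmall566` unfolded).
[cite: BalabanImbrieJaffe1988, (5.6.6) p.287] -/
theorem bgExp_bracket5514 {B : Type*} (ek η L : ℝ) (Q : B → ℂ) (θ HA DXf wA : B → ℝ) :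
    bgExp ek η Q (fun b => HA b - L⁻¹ ^ 2 * DXf b + wA b) =
      bgExp ek η (uTilde561 ek η L Q θ HA DXf) (fun b => θ b * HA b + wA b) := by
  funext b
  rw [← eq566 ek η L Q θ HA DXf wA b]
  rfl

/-- kernel: **`ũ_{k+1} = u′_k · exp(−ie_kη[θ_kH_{k,loc}A^{(k)} + w₁A′])`** pointwise — (5.6.6) inverted: the new background field is the (5.5.14)
field with the small field REMOVED. [cite: BalabanImbrieJaffe1988, (5.6.6) p.287] -/
theorem uTilde561_eq_mul_exp_neg {B : Type*} (ek η L : ℝ) (Q : B → ℂ) (θ HA DXf wA : B → ℝ) (b : B) :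
    uTilde561 ek η L Q θ HA DXf b =
      bgExp ek η Q (fun b => HA b - L⁻¹ ^ 2 * DXf b + wA b) b * exp (-(I * ((ek * η * (θ b * HA b + wA b) : ℝ) : ℂ))) := by
  rw [← eq566 ek η L Q θ HA DXf wA b, mul_assoc]
  have h : uSmall566 ek η θ HA wA b * exp (-(I * ((ek * η * (θ b * HA b + wA b) : ℝ) : ℂ))) = 1 := by
    rw [uSmall566, ← Complex.exp_add, add_neg_cancel, Complex.exp_zero]
  rw [h, mul_one]

/-- **"Thus removing θ_kH_{k,loc}A^{(k)} does not spoil the regularity, and ũ_{k+1} satisfies the regularity condition."** (p. 286 [PDF 30],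
with *"removed the small kernel w₁ … ∂w₁, ∂*w₁ are small, so the bounds remain valid"*).  If the (5.5.14) field `u′_k = (Q^{s*}_{k+1}v) exp
ie_kη[H_{k,loc}A^{(k)} − L^{−2}DXf + w₁A′]` (r16's `bgExp`, abstract `Q`, `HA`, `DXf`, `wA`) satisfies r16's regularity condition `Regular286`
on a family `G` of cubes with constant `c`, and the removed field `g = θ_k·H_{k,loc}A^{(k)} + w₁A′` obeys the three printed bounds `|g|, |∂^ηg|,
|∂^{η*}g| ≦ c′·p(e_k)·r(e_k)` on those cubes, then the (5.6.1) field `ũ_{k+1}` (r16's `uTilde561`, any `θ_k`, `L`) satisfies `Regular286` on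
`G` with constant `c + c′` (p36's `regular286_of_bgExp`). [cite: BalabanImbrieJaffe1988, (4.3) p.286] -/
theorem regular286_uTilde561 {γ : Type*} {cube : Balaban1983to89.Site P j → γ} {G : Set γ} {ek η c c' pek rek : ℝ} (L : ℝ)
    {Q : PBond P j → ℂ} {θ HA DXf wA : PBond P j → ℝ}
    (h : Regular286 cube G ek η c pek rek (bgExp ek η Q (fun b => HA b - L⁻¹ ^ 2 * DXf b + wA b)))
    (hg : ∀ q ∈ G, ∀ b ∈ starB (cubeSites cube q), |θ b * HA b + wA b| ≤ c' * pek * rek)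
    (hcurl : ∀ q ∈ G, ∀ p ∈ starP (cubeSites cube q), |curl η⁻¹ (fun b => θ b * HA b + wA b) p| ≤ c' * pek * rek)
    (hdiv : ∀ q ∈ G, ∀ x ∈ cubeSites cube q, |diverg η⁻¹ (fun b => θ b * HA b + wA b) x| ≤ c' * pek * rek) :
    Regular286 cube G ek η (c + c') pek rek (uTilde561 ek η L Q θ HA DXf) := by
  rw [bgExp_bracket5514 ek η L Q θ HA DXf wA] at h
  exact regular286_of_bgExp h hg hcurl hdiv

/-- **The torus instance.**  On the η-lattice torus (level `i`): `Q = Q^{s*}_{k+1}v` the concrete `(k+1)`-fold pull-back `qsstarGIter (k+1) v`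
read in `ℂ`, `HA = H_{k,loc}A`, `DXf = 𝒟^η_{k+1,loc}X_f` (linear data applied), `wA = w₁A′`, `θ = θ_k`; the background field after both
translations and the gauge transformation is ANY `U′` that agrees ON THE BONDS OF THE CUBES of `G` with the (5.5.14) form (what
`BIJ88Eq5514Torus.eq5514_torus` provides bond by bond — hypothesis `hEq`); if `U′` is `Regular286` on `G` with constant `c` and the removed field
obeys the three bounds at `c′`, then `ũ_{k+1} = uTilde561 e_k η L (Q^{s*}_{k+1}v) θ_k (H_{k,loc}A) (𝒟^η_{k+1,loc}X_f)` is `Regular286` on `G`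
with constant `c + c′` (r16's `regular286_of_eqOn` + `regular286_uTilde561`). [cite: BalabanImbrieJaffe1988, (4.3) p.286] -/
theorem regular286_uTilde561_torus {i k : ℕ} {γ : Type*} {cube : Balaban1983to89.Site P i → γ} {G : Set γ} {ek η c c' pek rek : ℝ}
    (L : ℝ) (v : GaugeField P (i + k + 1) U1) (Hloc : (PBond P (i + k) → ℝ) →ₗ[ℝ] (PBond P i → ℝ)) (A : PBond P (i + k) → ℝ)
    (Dnext : (PBond P i → ℝ) →ₗ[ℝ] (PBond P i → ℝ)) (Xf : PBond P i → ℝ) (θ wA : PBond P i → ℝ) {U' : PBond P i → ℂ}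
    (hEq : ∀ q ∈ G, ∀ b ∈ starB (cubeSites cube q),
      U' b = bgExp ek η (fun b => toC (qsstarGIter (k + 1) v b)) (fun b => Hloc A b - L⁻¹ ^ 2 * Dnext Xf b + wA b) b)
    (hU : Regular286 cube G ek η c pek rek U')
    (hg : ∀ q ∈ G, ∀ b ∈ starB (cubeSites cube q), |θ b * Hloc A b + wA b| ≤ c' * pek * rek)
    (hcurl : ∀ q ∈ G, ∀ p ∈ starP (cubeSites cube q), |curl η⁻¹ (fun b => θ b * Hloc A b + wA b) p| ≤ c' * pek * rek)
    (hdiv : ∀ q ∈ G, ∀ x ∈ cubeSites cube q, |diverg η⁻¹ (fun b => θ b * Hloc A b + wA b) x| ≤ c' * pek * rek) :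
    Regular286 cube G ek η (c + c') pek rek
      (uTilde561 ek η L (fun b => toC (qsstarGIter (k + 1) v b)) θ (fun b => Hloc A b) (fun b => Dnext Xf b)) := by
  have h' : Regular286 cube G ek η c pek rek
      (bgExp ek η (fun b => toC (qsstarGIter (k + 1) v b)) (fun b => Hloc A b - L⁻¹ ^ 2 * Dnext Xf b + wA b)) :=
    regular286_of_eqOn (fun q hq b hb => (hEq q hq b hb).symm) hU
  exact regular286_uTilde561 L h' hg hcurl hdiv

end

end Literature.MathematicalPhysics.QuantumFieldTheory.BalabanImbrieJaffe1984to88.BIJ88Regularity561
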